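import Mathlib.NumberTheory.SmoothNumbers
import Mathlib.Analysis.SpecialFunctions.Log.Basic
import Mathlib.Analysis.SpecialFunctions.Exp
import Mathlib.Data.Nat.Factorization.Basic
import Mathlib.Algebra.Order.BigOperators.Group.List
import HarnessLib

/-!
# Step (iii) of Tao–Teräväinen at `k = 0`: Landreau's splitting (Lemma 3.1 (i)) and the block
# inequality for subadditive exponents

Topic `Literature/Barriers/Parity`, sub-namespace `TaoTeravainen`; a file of the proof DAG of
`Literature.Barriers.Parity.TaoTeravainen2021_chowla`, towards `TaoTeravainen2021_lemma61`
(Lemma 6.1). Everything here is PROVED; the file is purely combinatorial (no characters).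

T. Tao, J. Teräväinen (arXiv:2109.06291), Lemma 3.1 (Landreau's inequality) (i): "If `n` is a
natural number and `y > z > 1`, then we can factor (3.8) `n = n_(>z) n₁ ⋯ n_m` where
`n₁, …, n_m ≤ y` lie in `ℕ_(≤z)` and `0 ≤ m ≤ 1 + log_{y/z} n`." In the proof of Lemma 6.1 this is
applied with `z = R`, `y = D` to the `R`-smooth part of `n`, and combined with the subadditivity
`a_{t,p^{j₁+j₂}} ≪ a_{t,p^{j₁}} + a_{t,p^{j₂}}`: "We then have `n_(p) = (n₁)_(p) ⋯ (n_m)_(p)` for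
all `p ≤ R`, and hence `a_{t,n_(p)} ≪ Σ_{i=1}^m a_{t,(n_i)_(p)}` … we conclude that
`|β_t| ∗ 1_(>R)(n) ≪ exp(O(Σ_{i=1}^m Σ_{p ≤ R} a_{t,(n_i)_(p)}))` and hence (since `m = O(1)`)
`≪ exp(O(Σ_{p ≤ R} a_{t,(n_i)_(p)}))` for some `i`." [cite: TaoTeravainen2021, Lemma 3.1 (i) and §6, proof of Lemma 6.1]

We prove:

* `exists_blocks` — **Landreau's splitting**: if every prime factor of `m ≥ 1` is `≤ B` and
  `B ≤ D'`, then `m` is the product of a non-empty list of divisors `≤ D'` of length `j` with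
  `(j - 1) log(D'/B) ≤ log m` (greedy: split off the largest divisor `≤ D'`, which is `> D'/B`);
* `expSum a d = Σ_{p ∣ d} a(p, v_p(d))` for an exponent `a : ℕ → ℕ → ℝ`, and `expSum_mul_le`:
  if `a ≥ 0`, `a(p, 0) = 0` and `a(p, k₁+k₂) ≤ 4(a(p,k₁) + a(p,k₂))` (`k₁, k₂ ≥ 1`), then
  `expSum a (xy) ≤ 4 (expSum a x + expSum a y)`, and `expSum_list_prod_le`:
  `expSum a (Π L) ≤ 4^{|L|-1} Σ_{d ∈ L} expSum a d`;
* **`exp_expSum_le_sum_divisors`** — the block inequality: under the same hypotheses, for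
  `B`-smooth `m ≥ 1`, `B ≤ D'`, `1 < D'/B` and `log m ≤ (J-1) log(D'/B)`,
  `exp(expSum a m) ≤ Σ_{d ∣ m, d ≤ D'} exp(expSum a d)^{J·4^{J-1}}`.
  [cite: TaoTeravainen2021, Lemma 3.1 (i) and §6, proof of Lemma 6.1]
-/

noncomputable section

open Finset Real

namespace Literature.Barriers.Parity.TaoTeravainen

/-! ### Landreau's splitting -/

/-- The largest divisor of `m` that is `≤ D'` (`m, D' ≥ 1`). [folklore] -/
def maxDivisorLE (m D' : ℕ) : ℕ :=
  if h : ((m.divisors.filter (· ≤ D')).Nonempty) then (m.divisors.filter (· ≤ D')).max' h else 1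

/-- Basic properties of `maxDivisorLE`. [folklore] -/
theorem maxDivisorLE_spec {m D' : ℕ} (hm : m ≠ 0) (hD : 1 ≤ D') :
    maxDivisorLE m D' ∣ m ∧ maxDivisorLE m D' ≤ D' ∧
      ∀ e, e ∣ m → e ≤ D' → e ≤ maxDivisorLE m D' := by
  have hne : (m.divisors.filter (· ≤ D')).Nonempty :=
    ⟨1, by rw [Finset.mem_filter, Nat.mem_divisors]; exact ⟨⟨one_dvd m, hm⟩, hD⟩⟩
  unfold maxDivisorLE
  rw [dif_pos hne]
  have hmem := Finset.max'_mem _ hne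
  rw [Finset.mem_filter, Nat.mem_divisors] at hmem
  refine ⟨hmem.1.1, hmem.2, fun e he heD => Finset.le_max' _ _ ?_⟩
  rw [Finset.mem_filter, Nat.mem_divisors]
  exact ⟨⟨he, hm⟩, heD⟩

/-- **Landreau's splitting** (Lemma 3.1 (i) with `z = B`, `y = D'`): a `B`-smooth `m ≥ 1`
(`B ≤ D'`) is the product of a non-empty list of numbers in `[1, D']`, all but at most one of
which exceed `D'/B`; quantitatively `(|L| - 1) log(D'/B) ≤ log m`.
[cite: TaoTeravainen2021, Lemma 3.1 (i)] -/
theorem exists_blocks {B D' : ℕ} (hB : 1 ≤ B) (hBD : B ≤ D') :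
    ∀ m : ℕ, m ≠ 0 → (∀ p, p.Prime → p ∣ m → p ≤ B) →
      ∃ L : List ℕ, L ≠ [] ∧ L.prod = m ∧ (∀ d ∈ L, 1 ≤ d ∧ d ≤ D') ∧
        ((L.length : ℝ) - 1) * Real.log ((D' : ℝ) / B) ≤ Real.log m := by
  intro m
  induction m using Nat.strong_induction_on with
  | _ m ih =>
    intro hm hsmooth
    have hD1 : 1 ≤ D' := hB.trans hBD
    by_cases hmD : m ≤ D'
    · refine ⟨[m], List.cons_ne_nil _ _, by simp, fun d hd => ?_, ?_⟩
      · rw [List.mem_singleton] at hd; subst hd; exact ⟨Nat.pos_of_ne_zero hm, hmD⟩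
      · simp only [List.length_singleton, Nat.cast_one, sub_self, zero_mul]
        exact Real.log_natCast_nonneg m
    · push Not at hmD
      obtain ⟨hdvd, hdD, hmax⟩ := maxDivisorLE_spec hm hD1
      set d := maxDivisorLE m D' with hd
      -- `d * B > D'`
      have hdB : D' < d * B := by
        by_contra hle
        push Not at hle
        obtain ⟨e, he⟩ := hdvd
        have he1 : e ≠ 1 := by
          rintro rfl; rw [mul_one] at he; rw [he] at hmD; exact absurd hdD (not_le.mpr hmD)
        obtain ⟨p, hp, hpe⟩ := Nat.exists_prime_and_dvd he1
        have hpm : p ∣ m := by rw [he]; exact hpe.mul_left d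
        have hpB : p ≤ B := hsmooth p hp hpm
        have h1 : d * p ∣ m := by rw [he]; exact mul_dvd_mul_left d hpe
        have h2 : d * p ≤ D' := (Nat.mul_le_mul_left d hpB).trans hle
        have h3 := hmax (d * p) h1 h2
        have h4 : d * 2 ≤ d * p := Nat.mul_le_mul_left d hp.two_le
        have hd0 : d ≠ 0 := by
          rintro h0; rw [h0, zero_mul] at he; exact hm he
        omega
      have hd2 : 2 ≤ d := by
        by_contra hlt
        push Not at hlt
        have hd01 : d = 0 ∨ d = 1 := by omega
        rcases hd01 with h0 | h1
        · rw [h0] at hdvd; exact hm (Nat.eq_zero_of_zero_dvd hdvd)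
        · rw [h1, one_mul] at hdB; exact absurd hBD (not_le.mpr hdB)
      obtain ⟨e, he⟩ := hdvd
      have he0 : e ≠ 0 := by rintro rfl; rw [mul_zero] at he; exact hm he
      have helt : e < m := by
        rw [he]; exact lt_mul_of_one_lt_left (Nat.pos_of_ne_zero he0) (by omega)
      have hesmooth : ∀ p, p.Prime → p ∣ e → p ≤ B := fun p hp hpe =>
        hsmooth p hp (he ▸ hpe.mul_left d)
      obtain ⟨L, hLne, hLprod, hLbd, hLlen⟩ := ih e helt he0 hesmooth
      refine ⟨d :: L, List.cons_ne_nil _ _, by rw [List.prod_cons, hLprod, he], ?_, ?_⟩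
      · intro x hx
        rw [List.mem_cons] at hx
        rcases hx with rfl | hx
        · exact ⟨by omega, hdD⟩
        · exact hLbd x hx
      · -- `(|L|) log(D'/B) ≤ log e + log(D'/B) ≤ log e + log d = log m`
        have hB0 : (0 : ℝ) < B := by exact_mod_cast hB
        have hd0 : (0 : ℝ) < d := by exact_mod_cast (show 0 < d by omega)
        have he0' : (0 : ℝ) < e := by exact_mod_cast Nat.pos_of_ne_zero he0
        have hlogd : Real.log ((D' : ℝ) / B) ≤ Real.log d := by
          refine Real.log_le_log (div_pos (by exact_mod_cast hD1) hB0) ?_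
          rw [div_le_iff₀ hB0]; exact_mod_cast hdB.le
        rw [List.length_cons, he, Nat.cast_mul, Real.log_mul hd0.ne' he0'.ne']
        push_cast
        have : ((L.length : ℝ) + 1 - 1) * Real.log ((D' : ℝ) / B) =
            ((L.length : ℝ) - 1) * Real.log ((D' : ℝ) / B) + Real.log ((D' : ℝ) / B) := by ring
        rw [this]
        linarith

/-! ### Exponent sums over prime factorisations and their subadditivity -/

/-- `expSum a d = Σ_{p ∣ d} a(p, v_p(d))`: the exponent of a multiplicative majorant
`Π_{p^k ∥ d} e^{a(p,k)}` (the source's `Σ_{p ≤ R} a_{t,d_(p)}`). [cite: TaoTeravainen2021, §6, proof of Lemma 6.1] -/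
def expSum (a : ℕ → ℕ → ℝ) (d : ℕ) : ℝ :=
  ∑ p ∈ d.primeFactors, a p (d.factorization p)

/-- `expSum a 1 = 0`. [folklore] -/
@[simp] theorem expSum_one (a : ℕ → ℕ → ℝ) : expSum a 1 = 0 := by simp [expSum]

/-- `expSum a d ≥ 0` for `a ≥ 0`. [folklore] -/
theorem expSum_nonneg {a : ℕ → ℕ → ℝ} (ha : ∀ p k, 0 ≤ a p k) (d : ℕ) : 0 ≤ expSum a d :=
  Finset.sum_nonneg fun p _ => ha p _

/-- `expSum` over a larger set of primes (the extra terms are `a(p, 0) = 0`). [folklore] -/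
theorem expSum_eq_sum_of_subset {a : ℕ → ℕ → ℝ} (ha0 : ∀ p, a p 0 = 0) {d : ℕ} {s : Finset ℕ}
    (hs : d.primeFactors ⊆ s) : expSum a d = ∑ p ∈ s, a p (d.factorization p) := by
  unfold expSum
  refine Finset.sum_subset hs fun p _ hp => ?_
  rw [← Nat.support_factorization, Finsupp.mem_support_iff, not_not] at hp
  rw [hp, ha0]

/-- **Subadditivity of `expSum` under multiplication**: if `a ≥ 0`, `a(p,0) = 0` and
`a(p, k₁+k₂) ≤ 4(a(p,k₁) + a(p,k₂))` for `k₁, k₂ ≥ 1` and the primes `p ∣ xy`, then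
`expSum a (xy) ≤ 4(expSum a x + expSum a y)`. [cite: TaoTeravainen2021, §6, proof of Lemma 6.1] -/
theorem expSum_mul_le {a : ℕ → ℕ → ℝ} (ha : ∀ p k, 0 ≤ a p k) (ha0 : ∀ p, a p 0 = 0) {x y : ℕ}
    (hx : x ≠ 0) (hy : y ≠ 0)
    (hsub : ∀ p ∈ (x * y).primeFactors, ∀ k₁ k₂, 1 ≤ k₁ → 1 ≤ k₂ →
      a p (k₁ + k₂) ≤ 4 * (a p k₁ + a p k₂)) :
    expSum a (x * y) ≤ 4 * (expSum a x + expSum a y) := by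
  have hsx : x.primeFactors ⊆ (x * y).primeFactors := Nat.primeFactors_mono (dvd_mul_right x y)
    (mul_ne_zero hx hy)
  have hsy : y.primeFactors ⊆ (x * y).primeFactors := Nat.primeFactors_mono (dvd_mul_left y x)
    (mul_ne_zero hx hy)
  rw [expSum_eq_sum_of_subset ha0 hsx, expSum_eq_sum_of_subset ha0 hsy, ← Finset.sum_add_distrib,
    Finset.mul_sum]
  unfold expSum
  refine Finset.sum_le_sum fun p hp => ?_
  rw [Nat.factorization_mul hx hy, Finsupp.add_apply]
  rcases Nat.eq_zero_or_pos (x.factorization p) with h1 | h1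
  · rw [h1, zero_add, ha0, zero_add]
    have := ha p (y.factorization p); linarith
  rcases Nat.eq_zero_or_pos (y.factorization p) with h2 | h2
  · rw [h2, add_zero, ha0, add_zero]
    have := ha p (x.factorization p); linarith
  exact hsub p hp _ _ h1 h2

/-- **Iterated subadditivity**: for a non-empty list `L` of positive integers,
`expSum a (Π L) ≤ 4^{|L|-1} Σ_{d ∈ L} expSum a d`. [cite: TaoTeravainen2021, §6, proof of Lemma 6.1] -/
theorem expSum_list_prod_le {a : ℕ → ℕ → ℝ} (ha : ∀ p k, 0 ≤ a p k) (ha0 : ∀ p, a p 0 = 0)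
    (hsub : ∀ p, p.Prime → ∀ k₁ k₂, 1 ≤ k₁ → 1 ≤ k₂ → a p (k₁ + k₂) ≤ 4 * (a p k₁ + a p k₂)) :
    ∀ L : List ℕ, L ≠ [] → (∀ d ∈ L, 1 ≤ d) →
      expSum a L.prod ≤ 4 ^ (L.length - 1) * (L.map (expSum a)).sum := by
  intro L
  induction L with
  | nil => intro h; exact absurd rfl h
  | cons d L ih =>
    intro _ hpos
    have hd : 1 ≤ d := hpos d (List.mem_cons_self)
    by_cases hL : L = []
    · subst hL; simp
    · have hLpos : ∀ e ∈ L, 1 ≤ e := fun e he => hpos e (List.mem_cons_of_mem d he)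
      have hprod : L.prod ≠ 0 := by
        rw [Ne, List.prod_eq_zero_iff]; intro h0; have := hLpos 0 h0; omega
      have h1 := expSum_mul_le (x := d) (y := L.prod) ha ha0 (by omega) hprod
        (fun p hp k₁ k₂ hk₁ hk₂ => hsub p (Nat.prime_of_mem_primeFactors hp) k₁ k₂ hk₁ hk₂)
      have h2 := ih hL hLpos
      rw [List.prod_cons, List.length_cons, List.map_cons, List.sum_cons]
      have hlen : 1 ≤ L.length := List.length_pos_of_ne_nil hL
      have hS : 0 ≤ (L.map (expSum a)).sum :=
        List.sum_nonneg (by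
          intro x hx; rw [List.mem_map] at hx; obtain ⟨e, -, rfl⟩ := hx; exact expSum_nonneg ha e)
      have hEd : 0 ≤ expSum a d := expSum_nonneg ha d
      have hpow : (4 : ℝ) * 4 ^ (L.length - 1) = 4 ^ (L.length + 1 - 1) := by
        rw [← pow_succ', show L.length - 1 + 1 = L.length + 1 - 1 by omega]
      have h4 : (4 : ℝ) ≤ 4 ^ (L.length + 1 - 1) := by
        calc (4 : ℝ) = 4 ^ 1 := (pow_one _).symm
          _ ≤ 4 ^ (L.length + 1 - 1) := pow_le_pow_right₀ (by norm_num) (by omega)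
      calc expSum a (d * L.prod) ≤ 4 * (expSum a d + expSum a L.prod) := h1
        _ ≤ 4 * (expSum a d + 4 ^ (L.length - 1) * (L.map (expSum a)).sum) := by linarith
        _ = 4 * expSum a d + (4 * 4 ^ (L.length - 1)) * (L.map (expSum a)).sum := by ring
        _ ≤ 4 ^ (L.length + 1 - 1) * expSum a d + 4 ^ (L.length + 1 - 1) * (L.map (expSum a)).sum := by
            rw [hpow]; nlinarith
        _ = 4 ^ (L.length + 1 - 1) * (expSum a d + (L.map (expSum a)).sum) := by ring

/-! ### The block inequality -/

/-- `Π_{d ∈ L} y_d ≤ M^{|L|}` when `0 ≤ y_d ≤ M` on `L`. [folklore] -/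
theorem list_map_prod_le_pow {L : List ℕ} {y : ℕ → ℝ} {M : ℝ} (h0 : ∀ d ∈ L, 0 ≤ y d)
    (hM : ∀ d ∈ L, y d ≤ M) : (L.map y).prod ≤ M ^ L.length := by
  induction L with
  | nil => simp
  | cons d L ih =>
    rw [List.map_cons, List.prod_cons, List.length_cons, pow_succ']
    have h0' : ∀ e ∈ L, 0 ≤ y e := fun e he => h0 e (List.mem_cons_of_mem d he)
    have hM' : ∀ e ∈ L, y e ≤ M := fun e he => hM e (List.mem_cons_of_mem d he)
    have hprod0 : 0 ≤ (L.map y).prod := List.prod_nonneg (by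
      intro x hx; rw [List.mem_map] at hx; obtain ⟨e, he, rfl⟩ := hx; exact h0' e he)
    exact mul_le_mul (hM d List.mem_cons_self) (ih h0' hM') hprod0
      ((h0 d List.mem_cons_self).trans (hM d List.mem_cons_self))

/-- **The block inequality, existential form** (Landreau's splitting combined with
subadditivity, as in the proof of Lemma 6.1: "`|β_t| ∗ 1_(>R)(n) ≪
exp(O(Σ_{i=1}^m Σ_{p≤R} a_{t,(n_i)_(p)}))` and hence (since `m = O(1)`)
`≪ exp(O(Σ_{p ≤ R} a_{t,(n_i)_(p)}))` for some `i`"): if `a ≥ 0`, `a(p,0) = 0`,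
`a(p,k₁+k₂) ≤ 4(a(p,k₁)+a(p,k₂))`, `m ≥ 1` is `B`-smooth, `1 ≤ B ≤ D'`, `1 < D'/B` and
`log m ≤ (J-1) log(D'/B)`, then for some divisor `d₀ ≤ D'` of `m`,
`exp(expSum a m) ≤ exp(expSum a d₀)^{J 4^{J-1}}`.
[cite: TaoTeravainen2021, Lemma 3.1 (i) and §6, proof of Lemma 6.1] -/
theorem exists_exp_expSum_le {a : ℕ → ℕ → ℝ} (ha : ∀ p k, 0 ≤ a p k) (ha0 : ∀ p, a p 0 = 0)
    (hsub : ∀ p, p.Prime → ∀ k₁ k₂, 1 ≤ k₁ → 1 ≤ k₂ → a p (k₁ + k₂) ≤ 4 * (a p k₁ + a p k₂))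
    {B D' : ℕ} (hB : 1 ≤ B) (hBD : B ≤ D') (hDB : (1 : ℝ) < (D' : ℝ) / B) {J : ℕ} (hJ : 1 ≤ J)
    {m : ℕ} (hm : m ≠ 0) (hsmooth : ∀ p, p.Prime → p ∣ m → p ≤ B)
    (hlen : Real.log m ≤ ((J : ℝ) - 1) * Real.log ((D' : ℝ) / B)) :
    ∃ d₀ : ℕ, d₀ ∣ m ∧ d₀ ≤ D' ∧
      Real.exp (expSum a m) ≤ Real.exp (expSum a d₀) ^ (J * 4 ^ (J - 1)) := by
  classical
  obtain ⟨L, hLne, hLprod, hLbd, hLlog⟩ := exists_blocks hB hBD m hm hsmooth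
  have hlogDB : 0 < Real.log ((D' : ℝ) / B) := Real.log_pos hDB
  -- the number of blocks is at most `J`
  have hLJ : L.length ≤ J := by
    have h : ((L.length : ℝ) - 1) * Real.log ((D' : ℝ) / B) ≤ ((J : ℝ) - 1) * Real.log ((D' : ℝ) / B) :=
      hLlog.trans hlen
    have h' : (L.length : ℝ) - 1 ≤ (J : ℝ) - 1 := le_of_mul_le_mul_right h hlogDB
    have : (L.length : ℝ) ≤ J := by linarith
    exact_mod_cast this
  -- `expSum a m ≤ 4^{J-1} Σ_{d ∈ L} expSum a d`
  have hpos : ∀ d ∈ L, 1 ≤ d := fun d hd => (hLbd d hd).1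
  have h1 : expSum a m ≤ 4 ^ (J - 1) * (L.map (expSum a)).sum := by
    have h := expSum_list_prod_le ha ha0 hsub L hLne hpos
    rw [hLprod] at h
    refine h.trans (mul_le_mul_of_nonneg_right (pow_le_pow_right₀ (by norm_num) (by omega)) ?_)
    exact List.sum_nonneg (by
      intro x hx; rw [List.mem_map] at hx; obtain ⟨e, -, rfl⟩ := hx; exact expSum_nonneg ha e)
  -- exponentiate: `exp(4^{J-1} Σ) = Π exp(expSum d)^{4^{J-1}}`
  set c : ℕ := 4 ^ (J - 1) with hc
  have h2 : ∀ L' : List ℕ, Real.exp (4 ^ (J - 1) * (L'.map (expSum a)).sum) =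
      (L'.map fun d => Real.exp (expSum a d) ^ c).prod := by
    intro L'
    rw [hc]
    induction L' with
    | nil => simp
    | cons e L' ih2 =>
      rw [List.map_cons, List.sum_cons, mul_add, Real.exp_add, List.map_cons, List.prod_cons,
        ← Real.exp_nat_mul, ih2]
      congr 1; push_cast; ring_nf
  -- the largest block value dominates: `Π_{d ∈ L} y_d^c ≤ (max y)^{cJ}`
  set y : ℕ → ℝ := fun d => Real.exp (expSum a d) with hy
  have hy1 : ∀ d, 1 ≤ y d := fun d => Real.one_le_exp (expSum_nonneg ha d)
  obtain ⟨x₀, hx₀⟩ := List.exists_mem_of_ne_nil L hLne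
  obtain ⟨d₀, hd₀, hmax⟩ := L.toFinset.exists_max_image y ⟨x₀, List.mem_toFinset.mpr hx₀⟩
  rw [List.mem_toFinset] at hd₀
  have h3 : (L.map fun d => y d ^ c).prod ≤ (y d₀ ^ c) ^ J := by
    have h := list_map_prod_le_pow (L := L) (y := fun d => y d ^ c) (M := y d₀ ^ c)
      (fun d _ => by positivity) (fun d hd => by
        have := hmax d (List.mem_toFinset.mpr hd)
        exact pow_le_pow_left₀ (zero_le_one.trans (hy1 d)) this c)
    exact h.trans (pow_le_pow_right₀ (one_le_pow₀ (hy1 d₀)) hLJ)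
  refine ⟨d₀, hLprod ▸ List.dvd_prod hd₀, (hLbd d₀ hd₀).2, ?_⟩
  calc Real.exp (expSum a m) ≤ Real.exp (4 ^ (J - 1) * (L.map (expSum a)).sum) :=
        Real.exp_le_exp.mpr h1
    _ = (L.map fun d => y d ^ c).prod := h2 L
    _ ≤ (y d₀ ^ c) ^ J := h3
    _ = y d₀ ^ (J * c) := by rw [← pow_mul, mul_comm]

/-- **The block inequality, divisor-sum form**: under the same hypotheses,
`exp(expSum a m) ≤ Σ_{d ∣ m, d ≤ D'} exp(expSum a d)^{J 4^{J-1}}`.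
[cite: TaoTeravainen2021, Lemma 3.1 (i) and §6, proof of Lemma 6.1] -/
theorem exp_expSum_le_sum_divisors {a : ℕ → ℕ → ℝ} (ha : ∀ p k, 0 ≤ a p k) (ha0 : ∀ p, a p 0 = 0)
    (hsub : ∀ p, p.Prime → ∀ k₁ k₂, 1 ≤ k₁ → 1 ≤ k₂ → a p (k₁ + k₂) ≤ 4 * (a p k₁ + a p k₂))
    {B D' : ℕ} (hB : 1 ≤ B) (hBD : B ≤ D') (hDB : (1 : ℝ) < (D' : ℝ) / B) {J : ℕ} (hJ : 1 ≤ J)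
    {m : ℕ} (hm : m ≠ 0) (hsmooth : ∀ p, p.Prime → p ∣ m → p ≤ B)
    (hlen : Real.log m ≤ ((J : ℝ) - 1) * Real.log ((D' : ℝ) / B)) :
    Real.exp (expSum a m) ≤
      ∑ d ∈ m.divisors.filter (· ≤ D'), Real.exp (expSum a d) ^ (J * 4 ^ (J - 1)) := by
  classical
  obtain ⟨d₀, hd₀m, hd₀D, h⟩ := exists_exp_expSum_le ha ha0 hsub hB hBD hDB hJ hm hsmooth hlen
  have hd₀S : d₀ ∈ m.divisors.filter (· ≤ D') := by
    rw [Finset.mem_filter, Nat.mem_divisors]; exact ⟨⟨hd₀m, hm⟩, hd₀D⟩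
  refine h.trans ?_
  exact Finset.single_le_sum (f := fun d => Real.exp (expSum a d) ^ (J * 4 ^ (J - 1)))
    (fun d _ => by positivity) hd₀S

end Literature.Barriers.Parity.TaoTeravainen
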